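import Literature.Probability.Percolation.Percolation
import HarnessLib

/-!
# `NoHeavyLowerTail` (stmt-CriticalPhenomena-4575) — gluing LINKS into a configuration: the pointwise comparison lemmas of the
# level-two observer-set theorem for two-port star sets (step (2) of `setCS_twoPortStars_levelTwo`, seat memo R3-SEATS.md §7)

Support file (prover `prim-gen-swap` gen 6; `--supports stmt-CriticalPhenomena-4575`).  No definitions, no named facts, no sorries; Mathlib +
`Literature.Probability.Percolation.Percolation` only (lands independently of the farm state of the Summits chain).

A LINK is a pair `e = s(p, p')` of two distinct relays; `Λ` a set of links, `V(Λ)` their endpoints, `ω ∪ Λ` the configuration with the links opened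
(the relay-side effect of a two-port pendant star whose two port edges are open).  For an observer/witness `c` that is not a link endpoint:

* `StarSet.reachable_of_adjClosed` — a set containing `x` and closed under adjacency contains the component of `x` (walk induction).
* `StarSet.reachable_union_links_iff` — if no link endpoint is joined to `c` in `ω`, opening the links does not change the cluster of `c`.
* `StarSet.exists_reachable_union_links` — whatever a set `R` reaches in `ω ∪ Λ` is reached in `ω` from `R ∪ V(Λ)`.
* `StarSet.three_le_card_of_reachable_link` — if `c ∈ A` is joined in `ω ∪ Λ` to an endpoint of a link with both endpoints in `A ∖ {c}`, then
  `c` sees at least three relays.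
* `StarSet.sepSmall_links_iff` (ρ-part, `j ≤ 2`): `c ↮_ω R ∪ V(Λ) ∧ |π_ω(c)| ≤ j  ↔  c ↮_{ω∪Λ} R ∧ |π_{ω∪Λ}(c)| ≤ j`.
* `StarSet.sepLonely_links_of` (ℓ-part, any `j`, `R ∩ A ≠ ∅`): `c ↮_ω R ∪ V(Λ) ∧ 1 ≤ |π_ω(R ∪ V(Λ))| ≤ j  →  c ↮_{ω∪Λ} R ∧ 1 ≤ |π_{ω∪Λ}(R)| ≤ j`.
These are exactly the two pointwise facts behind "every term with a glued star dominates the relay-set row" in the proof of the level-two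
observer-set inequality for any number of two-port stars (R3-SEATS.md §7 step (2)); integrating them against the link law gives
`term_e ≥ CSdiff(R_e; c)`.
-/

namespace Summit.CriticalPhenomena.PercolationContinuityZ3.Theorems

open Set Literature.Probability.Percolation
open scoped Classical

variable {n : ℕ}

namespace StarSet

/-- A set containing `x` and closed under adjacency contains everything reachable from `x`. [folklore] -/
theorem reachable_of_adjClosed {V : Type*} (G : SimpleGraph V) (S : Set V) {x y : V} (hx : x ∈ S)
    (hS : ∀ u v, u ∈ S → G.Adj u v → v ∈ S) (h : G.Reachable x y) : y ∈ S := by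
  obtain ⟨p⟩ := h
  induction p with
  | nil => exact hx
  | cons hadj _ ih => exact ih (hS _ _ hx hadj)

/-- Adjacency in `ω ∪ Λ` is adjacency in `ω` or along a link. [folklore] -/
theorem adj_union_iff (ω Λ : BondConfig (Fin n)) (u v : Fin n) :
    (openGraph (ω ∪ Λ)).Adj u v ↔ (openGraph ω).Adj u v ∨ (s(u, v) ∈ Λ ∧ u ≠ v) := by
  simp only [openGraph_adj, mem_union]
  tauto

/-- Monotonicity of reachability under opening more pairs. [folklore] -/
theorem reachable_mono_union (ω Λ : BondConfig (Fin n)) {x y : Fin n} (h : (openGraph ω).Reachable x y) :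
    (openGraph (ω ∪ Λ)).Reachable x y := by
  refine h.mono ?_
  intro u v huv
  rw [openGraph_adj] at huv ⊢
  exact ⟨mem_union_left _ huv.1, huv.2⟩

/-- **Opening links away from `c` does not change the cluster of `c`.**  If no endpoint of a link of `Λ` is joined to `c` in `ω`, then
`c ↔ y` in `ω ∪ Λ` iff `c ↔ y` in `ω`. [folklore] -/
theorem reachable_union_links_iff (ω Λ : BondConfig (Fin n)) (c : Fin n)
    (hfar : ∀ e ∈ Λ, ∀ v ∈ e, ¬ (openGraph ω).Reachable c v) (y : Fin n) :
    (openGraph (ω ∪ Λ)).Reachable c y ↔ (openGraph ω).Reachable c y := by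
  refine ⟨fun h => ?_, reachable_mono_union ω Λ⟩
  refine reachable_of_adjClosed (openGraph (ω ∪ Λ)) {v | (openGraph ω).Reachable c v} (x := c)
    (SimpleGraph.Reachable.refl c) ?_ h
  intro u v hu huv
  rw [mem_setOf_eq] at hu ⊢
  rcases (adj_union_iff ω Λ u v).1 huv with hω | ⟨hΛ, _⟩
  · exact hu.trans hω.reachable
  · exact absurd hu (hfar _ hΛ u (Sym2.mem_mk_left u v))

/-- **Whatever `R` reaches through the links is reached in `ω` from `R` or from a link endpoint.** [folklore] -/
theorem exists_reachable_union_links (ω Λ : BondConfig (Fin n)) (R : Finset (Fin n)) {z : Fin n}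
    (h : ∃ y ∈ R, (openGraph (ω ∪ Λ)).Reachable y z) :
    ∃ y, (y ∈ R ∨ ∃ e ∈ Λ, y ∈ e) ∧ (openGraph ω).Reachable y z := by
  obtain ⟨y₀, hy₀, hreach⟩ := h
  refine reachable_of_adjClosed (openGraph (ω ∪ Λ))
    {x | ∃ y, (y ∈ R ∨ ∃ e ∈ Λ, y ∈ e) ∧ (openGraph ω).Reachable y x} (x := y₀)
    ⟨y₀, Or.inl hy₀, SimpleGraph.Reachable.refl y₀⟩ ?_ hreach
  rintro u v ⟨y, hy, hyu⟩ huv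
  rcases (adj_union_iff ω Λ u v).1 huv with hω | ⟨hΛ, _⟩
  · exact ⟨y, hy, hyu.trans hω.reachable⟩
  · exact ⟨v, Or.inr ⟨s(u, v), hΛ, Sym2.mem_mk_right u v⟩, SimpleGraph.Reachable.refl v⟩

/-- **A relay joined to a link sees three relays.**  If `c ∈ A` is joined in `ω ∪ Λ` to an endpoint of a link `e ∈ Λ` whose two
(distinct) endpoints lie in `A ∖ {c}`, then at least three relays are joined to `c`. [folklore] -/
theorem three_le_card_of_reachable_link (ω Λ : BondConfig (Fin n)) (A : Finset (Fin n)) (c : Fin n) (hcA : c ∈ A)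
    {p p' : Fin n} (hpp' : p ≠ p') (hpA : p ∈ A) (hp'A : p' ∈ A) (hpc : p ≠ c) (hp'c : p' ≠ c)
    (he : s(p, p') ∈ Λ) (hreach : (openGraph (ω ∪ Λ)).Reachable c p) :
    3 ≤ (A.filter fun z => (openGraph (ω ∪ Λ)).Reachable c z).card := by
  have hadj : (openGraph (ω ∪ Λ)).Adj p p' := by
    rw [openGraph_adj]; exact ⟨mem_union_right _ he, hpp'⟩
  have hp' : (openGraph (ω ∪ Λ)).Reachable c p' := hreach.trans hadj.reachable
  have hsub : ({c, p, p'} : Finset (Fin n)) ⊆ A.filter fun z => (openGraph (ω ∪ Λ)).Reachable c z := by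
    intro z hz
    simp only [Finset.mem_insert, Finset.mem_singleton] at hz
    rw [Finset.mem_filter]
    rcases hz with rfl | rfl | rfl
    · exact ⟨hcA, SimpleGraph.Reachable.refl _⟩
    · exact ⟨hpA, hreach⟩
    · exact ⟨hp'A, hp'⟩
  have hcard : ({c, p, p'} : Finset (Fin n)).card = 3 := by
    rw [Finset.card_insert_of_notMem, Finset.card_insert_of_notMem, Finset.card_singleton]
    · simpa using hpp'
    · simp only [Finset.mem_insert, Finset.mem_singleton, not_or]; exact ⟨hpc.symm, hp'c.symm⟩
  calc 3 = ({c, p, p'} : Finset (Fin n)).card := hcard.symm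
    _ ≤ _ := Finset.card_le_card hsub

/-- **ρ-part (level `j ≤ 2`).**  Links with distinct endpoints in `A ∖ {c}`, `c ∈ A`:
`(c ↮_ω R ∪ V(Λ)) ∧ |π_ω(c)| ≤ j  ↔  (c ↮_{ω∪Λ} R) ∧ |π_{ω∪Λ}(c)| ≤ j`. [folklore] -/
theorem sepSmall_links_iff (ω : BondConfig (Fin n)) (Λ : Finset (Sym2 (Fin n))) (A R : Finset (Fin n)) (c : Fin n) (j : ℕ)
    (hj : j ≤ 2) (hcA : c ∈ A)
    (hΛ : ∀ e ∈ Λ, ∃ p p', e = s(p, p') ∧ p ≠ p' ∧ p ∈ A ∧ p' ∈ A ∧ p ≠ c ∧ p' ≠ c) :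
    ((∀ y ∈ R, ¬ (openGraph ω).Reachable c y) ∧ (∀ e ∈ Λ, ∀ v ∈ e, ¬ (openGraph ω).Reachable c v) ∧
        (A.filter fun z => (openGraph ω).Reachable c z).card ≤ j) ↔
      ((∀ y ∈ R, ¬ (openGraph (ω ∪ ↑Λ)).Reachable c y) ∧
        (A.filter fun z => (openGraph (ω ∪ ↑Λ)).Reachable c z).card ≤ j) := by
  constructor
  · rintro ⟨hR, hfar, hsmall⟩
    have hiff := reachable_union_links_iff ω (↑Λ) c (fun e he v hv => hfar e (Finset.mem_coe.1 he) v hv)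
    refine ⟨fun y hy h => hR y hy ((hiff y).1 h), ?_⟩
    have hset : (A.filter fun z => (openGraph (ω ∪ ↑Λ)).Reachable c z) = A.filter fun z => (openGraph ω).Reachable c z :=
      Finset.filter_congr fun z _ => hiff z
    rw [hset]; exact hsmall
  · rintro ⟨hR, hsmall⟩
    -- no link endpoint is joined to `c` even in `ω ∪ Λ`: otherwise `c` sees three relays
    have hfar' : ∀ e ∈ Λ, ∀ v ∈ e, ¬ (openGraph (ω ∪ ↑Λ)).Reachable c v := by
      intro e he v hv hcv
      obtain ⟨p, p', rfl, hpp', hpA, hp'A, hpc, hp'c⟩ := hΛ e he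
      have he' : s(p, p') ∈ (↑Λ : Set (Sym2 (Fin n))) := Finset.mem_coe.2 he
      rcases Sym2.mem_iff.1 hv with rfl | rfl
      · have := three_le_card_of_reachable_link ω ↑Λ A c hcA hpp' hpA hp'A hpc hp'c he' hcv
        omega
      · have he'' : s(v, p) ∈ (↑Λ : Set (Sym2 (Fin n))) := by rw [Sym2.eq_swap]; exact he'
        have := three_le_card_of_reachable_link ω ↑Λ A c hcA hpp'.symm hp'A hpA hp'c hpc he'' hcv
        omega
    have hfar : ∀ e ∈ (↑Λ : Set (Sym2 (Fin n))), ∀ v ∈ e, ¬ (openGraph ω).Reachable c v :=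
      fun e he v hv h => hfar' e (Finset.mem_coe.1 he) v hv (reachable_mono_union ω ↑Λ h)
    have hiff := reachable_union_links_iff ω (↑Λ) c hfar
    refine ⟨fun y hy h => hR y hy ((hiff y).2 h), fun e he v hv h => hfar' e he v hv (reachable_mono_union ω ↑Λ h), ?_⟩
    have hset : (A.filter fun z => (openGraph ω).Reachable c z) = A.filter fun z => (openGraph (ω ∪ ↑Λ)).Reachable c z :=
      Finset.filter_congr fun z _ => (hiff z).symm
    rw [hset]; exact hsmall

/-- **ℓ-part (any level).**  If `c` is separated in `ω` from `R` and from every link endpoint, and the relays reached in `ω` from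
`R ∪ V(Λ)` number between `1` and `j`, then in `ω ∪ Λ` the vertex `c` is separated from `R` and the relays reached from `R` number at most
`j` — and at least `1` as soon as `R` contains a relay. [folklore] -/
theorem sepLonely_links_of (ω : BondConfig (Fin n)) (Λ : Finset (Sym2 (Fin n))) (A R : Finset (Fin n)) (c : Fin n) (j : ℕ)
    (hRA : ∃ r ∈ R, r ∈ A)
    (h : (∀ y ∈ R, ¬ (openGraph ω).Reachable c y) ∧ (∀ e ∈ Λ, ∀ v ∈ e, ¬ (openGraph ω).Reachable c v) ∧
      (A.filter fun z => ∃ y, (y ∈ R ∨ ∃ e ∈ Λ, y ∈ e) ∧ (openGraph ω).Reachable y z).card ≤ j) :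
    (∀ y ∈ R, ¬ (openGraph (ω ∪ ↑Λ)).Reachable c y) ∧
      1 ≤ (A.filter fun z => ∃ y ∈ R, (openGraph (ω ∪ ↑Λ)).Reachable y z).card ∧
      (A.filter fun z => ∃ y ∈ R, (openGraph (ω ∪ ↑Λ)).Reachable y z).card ≤ j := by
  obtain ⟨hR, hfar, hsmall⟩ := h
  have hiff := reachable_union_links_iff ω (↑Λ) c (fun e he v hv => hfar e (Finset.mem_coe.1 he) v hv)
  refine ⟨fun y hy h => hR y hy ((hiff y).1 h), ?_, ?_⟩
  · obtain ⟨r, hrR, hrA⟩ := hRA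
    exact Finset.card_pos.2 ⟨r, Finset.mem_filter.2 ⟨hrA, r, hrR, SimpleGraph.Reachable.refl r⟩⟩
  · refine le_trans (Finset.card_le_card fun z hz => ?_) hsmall
    rw [Finset.mem_filter] at hz ⊢
    refine ⟨hz.1, ?_⟩
    obtain ⟨y, hy, hyz⟩ := exists_reachable_union_links ω (↑Λ) R hz.2
    refine ⟨y, ?_, hyz⟩
    rcases hy with hy | ⟨e, he, hye⟩
    · exact Or.inl hy
    · exact Or.inr ⟨e, Finset.mem_coe.1 he, hye⟩

end StarSet

end Summit.CriticalPhenomena.PercolationContinuityZ3.Theorems
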